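import Literature.Barriers.QuantumAdvantage.AaronsonChenAdviceWeights
import Literature.Computability.Cryptography.QuantumCircuitDescFP
import Literature.Computability.QuantumComplexity.ADHPathModel
import Literature.Computability.Complexity.CodeFPArith
import Literature.Computability.Complexity.CodeFPBudgets
import HarnessLib

/-!
# Aaronson–Chen 2017, Lemma 5.3: the replaced circuit's parameters read off the game input in polynomial time

Support file for `aaronsonChen2017_lem53` (`AaronsonChenOracle.lean`), on the line
`aaronsonChen2017_lem53_of_advice` (`AaronsonChenMachine.lean`) → `advLang ∈ PSPACE` →
`HeavyLang, CdfLang ∈ PSPACE` (`AaronsonChenAdvice.lean`) → threshold tests `linFormTest` on the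
path-pair counts of the annotated prefix `AcSim.annTab (tabsOf x₀ r h) (gates.take n)` from the basis
label `w0 x₀` with coefficients `2^{hCount (gates.take n)}`, `bud x₀`, `2^{|r|}`, `⟦r⟧`
(`AaronsonChenAdviceWeights.lean`). A polynomial-space evaluation of those counts reads the circuit
from CODES; this file reads the protocol's circuit data off the game input `x₀` in polynomial time
(`CodeFP`, `Complexity/CodeFP.lean`), from the UNIFORMITY of the family ("`M`" is a `SampBQP`
algorithm, i.e. a polynomial-time uniform family; Aaronson–Chen §2.2 p. 12, §5.3 pp. 22–23) through
the tree's description function (`QuantumCircuitDescFP.lean`: `F.IsUniform ↔ F.descFn ∈ FP`):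

* gate codes: `isOracleCode`, `isHCode`, `kOfCode` (tag, Hadamard test, number of query wires of a
  gate code `QGate.encode g`; `isOracleCode_encode`, `isHCode_encode`, `kOfCode_encode_oracle`) and
  their `CodeFP` forms; `hCount_eq_length_filter`, `oracleQueries_eq_length_filter`;
* from `x₀` (given `hU : P.F.IsUniform`): `desc_code` (`(|x₀|, ancillas, gate codes)`),
  `gateCodes_code`, `ancillas_code`, `nq_code`, **`w0Bits_code`** (the basis label `x₀ 0^m` of
  `|x₀, 0^m⟩` as a bit string, `ofFn_w0`), `oracleQueries_code`, **`bud_code`** (the budget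
  `a = b = (|x₀| + T + 2)^c`), and with a binary prefix length `n`: **`gateCodesTake_code`**,
  **`hCountTake_code`**, `gateCodeAt_code` (the code of gate `n`, `ε` past the end; `encode_ne_nil`).

With `AaronsonChenAdviceTables.lean` (the per-gate tables read off the history) these are all the
inputs of the annotated prefix; what remains for `HeavyLang, CdfLang ∈ PSPACE` is the polynomial-space
evaluation of `linFormTest` on coded annotated gate lists.

## References

* [AaronsonChen2017] S. Aaronson, L. Chen, CCC 2017 (doi:10.4230/LIPIcs.CCC.2017.22;
  arXiv:1612.05903), §2.2 (p. 12: `SampBQP`, uniform families), §5.3 (pp. 22–23), read via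
  `lit read arxiv:1612.05903 --pages 21-23`.
* [AroraBarak2009] §6.2 (P-uniform families), §1.2–1.3 (polynomial time), as packaged in
  `QuantumCircuitDescFP.lean` and `Complexity/CodeFP.lean`.
-/

noncomputable section

namespace Literature.Barriers.QuantumAdvantage

open MeasureTheory _root_.Computability Polynomial Literature.Computability.Complexity
  Literature.Computability.Complexity.Brick Literature.Computability.Complexity.Plumb
  Literature.Computability.Cryptography Literature.Computability.QuantumComplexity CodeFP

/-! ### Gate codes: tag, Hadamard test, number of query wires -/

/-- A gate code is an ORACLE gate code iff its tag bit is `1` (`QGate.encode`: tag `0` = gate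
symbol, `1` = oracle query). [folklore] -/
def isOracleCode (w : List Bool) : Bool := decide (w.take 1 = [true])

/-- A gate code is the code of a HADAMARD gate iff its tag is `0` and its symbol numeral is `0`
(`Encodable.encode CliffordTOp.H = 0`, coded by `ε`). [folklore] -/
def isHCode (w : List Bool) : Bool := decide (w.take 1 = [false]) && decide (fstF (w.drop 1) = [])

/-- The number of query wires recorded in an oracle gate code. [folklore] -/
def kOfCode (w : List Bool) : ℕ := bitsToNat (fstF (w.drop 1))

variable {N : ℕ}

/-- The tag test reads oracle gates. [folklore] -/
theorem isOracleCode_encode (g : QGate cliffordT N) : isOracleCode g.encode = decide (¬ g.IsOracleFree) := by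
  cases g <;> simp [isOracleCode, QGate.encode, QGate.IsOracleFree]

/-- A binary numeral is empty iff it codes `0` (twin of `TavRecode.encodeNat_eq_nil_iff`,
`AlgebraicComplexity/RealTauConjectureDefinable.lean`, behind unrelated imports; re-proved here). [folklore] -/
theorem encodeNat_eq_nil_iff (n : ℕ) : encodeNat n = [] ↔ n = 0 := by
  constructor
  · intro h
    have e := bitsToNat_encodeNat n
    rw [h] at e
    simpa using e.symm
  · rintro rfl
    rfl

/-- The Hadamard test reads Hadamard gates. [folklore] -/
theorem isHCode_encode (g : QGate cliffordT N) : isHCode g.encode = QGateIsH g := by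
  cases g with
  | oracle k e => simp [isHCode, QGate.encode, QGateIsH]
  | gate op e =>
    have h : isHCode (QGate.encode (.gate op e : QGate cliffordT N)) = decide (Encodable.encode op = 0) := by
      simp [isHCode, QGate.encode, fstF_boolPair, encodeNat_eq_nil_iff]
    rw [h]
    cases op <;> simp [QGateIsH] <;> decide

/-- The query-wire count of an oracle gate code. [folklore] -/
theorem kOfCode_encode_oracle (k : ℕ) (e : Fin (k + 1) ↪ Fin N) :
    kOfCode (QGate.encode (.oracle k e : QGate cliffordT N)) = k := by
  simp [kOfCode, QGate.encode, fstF_boolPair]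

/-- The tag test on codes. [folklore] -/
theorem isOracleCode_code : CodeFP strE bitE isOracleCode :=
  ((CodeFP.eq (eα := strE) (fun _ _ h => h)).comp
    ((strTake.comp ((CodeFP.const strE 1).pair (CodeFP.id strE))).pair (CodeFP.const strE [true])) :).congr
    fun _ => rfl

/-- `fstF` on codes (it is a brick). [folklore] -/
theorem fstF_code : CodeFP strE strE fstF := CodeFP.of_fn fstF fstF_mem_FP fun _ => rfl

/-- The Hadamard test on codes. [folklore] -/
theorem isHCode_code : CodeFP strE bitE isHCode := by
  have h1 : CodeFP strE bitE (fun w => decide (w.take 1 = [false])) :=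
    ((CodeFP.eq (eα := strE) (fun _ _ h => h)).comp
      ((strTake.comp ((CodeFP.const strE 1).pair (CodeFP.id strE))).pair (CodeFP.const strE [false])) :)
  have h2 : CodeFP strE bitE (fun w => decide (fstF (w.drop 1) = [])) :=
    ((CodeFP.eq (eα := strE) (fun _ _ h => h)).comp
      ((fstF_code.comp (strDrop.comp ((CodeFP.const strE 1).pair (CodeFP.id strE)))).pair (CodeFP.const strE [])) :)
  exact (h1.and h2).congr fun _ => rfl

/-- The query-wire count on codes. [folklore] -/
theorem kOfCode_code : CodeFP strE natE kOfCode :=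
  ((strVal.comp (fstF_code.comp (strDrop.comp ((CodeFP.const strE 1).pair (CodeFP.id strE))))) :).congr fun _ => rfl

/-- **The Hadamard count is the number of Hadamard gate codes.** [folklore] -/
theorem hCount_eq_length_filter (gs : List (QGate cliffordT N)) :
    hCount gs = ((gs.map QGate.encode).filter isHCode).length := by
  rw [hCount, List.countP_eq_length_filter, List.filter_map, List.length_map]
  congr 1
  exact List.filter_congr fun g _ => (isHCode_encode g).symm

/-- **The query count is the number of oracle gate codes.** [folklore] -/
theorem oracleQueries_eq_length_filter (C : QCircuit cliffordT N) :
    C.oracleQueries = ((C.gates.map QGate.encode).filter isOracleCode).length := by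
  rw [QCircuit.oracleQueries, List.filter_map, List.length_map]
  congr 1
  exact List.filter_congr fun g _ => by rw [Function.comp_apply, isOracleCode_encode]

/-- Taking at least the whole list. [folklore] -/
theorem take_min_length {α : Type*} (l : List α) (n : ℕ) : l.take (min n l.length) = l.take n := by
  rcases le_total n l.length with h | h
  · rw [min_eq_left h]
  · rw [min_eq_right h, List.take_length, List.take_of_length_le h]

/-- A filter without context, on raw lists. [folklore] -/
theorem filter₀ {α : Type} {eα : α → List Bool} {p : α → Bool} (hp : CodeFP eα bitE p) :
    CodeFP (rawE eα) (rawE eα) (fun l => l.filter p) :=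
  ((CodeFP.filter (σ := Unit) (eσ := fun _ => []) (hp.comp (CodeFP.snd _ eα))).comp
    ((CodeFP.const (rawE eα) ()).pair (CodeFP.id (rawE eα)))).congr fun _ => rfl

/-- The zero string of a unary length. [folklore] -/
theorem zeros_code : CodeFP unE strE (fun m => List.replicate m false) :=
  CodeFP.of_fn Kannan.zerosFn Kannan.zerosFn_mem_FP fun m => by rw [Kannan.zerosFn_apply, length_unE]; rfl

/-! ### The circuit data of the protocol, read off the game input -/

namespace AcProto

variable (P : AcProto)

/-- **The description of the circuit run on `x₀`**, from uniformity: `(|x₀|, ancillas, gate codes)`.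
[cite: AaronsonChen2017, §2.2 (p. 12, SampBQP: polynomial-time uniform families)] [cite: AroraBarak2009, §6.2] -/
theorem desc_code (hU : P.F.IsUniform) :
    CodeFP strE (pairE natE (pairE unE (rawE strE)))
      (fun x₀ => (x₀.length, P.F.ancillas x₀.length, (P.gates x₀).map QGate.encode)) :=
  CodeFP.of_fn P.F.descFn (QCircuitFamily.descFn_mem_FP_of_isUniform hU) fun x₀ => by
    have e : List.map strE (List.map QGate.encode (P.gates x₀)) = List.map QGate.encode (P.gates x₀) := List.map_id _
    rw [QCircuitFamily.descFn_eq, QCircuit.encode_eq_encList, pairE_apply, pairE_apply]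
    simp only [rawE]
    rw [e]
    rfl

/-- The gate codes of the circuit run on `x₀`. [folklore] -/
theorem gateCodes_code (hU : P.F.IsUniform) : CodeFP strE (rawE strE) (fun x₀ => (P.gates x₀).map QGate.encode) :=
  (P.desc_code hU).snd'.snd'.congr fun _ => rfl

/-- The ancilla count of the circuit run on `x₀`, unary. [folklore] -/
theorem ancillas_code (hU : P.F.IsUniform) : CodeFP strE unE (fun x₀ => P.F.ancillas x₀.length) :=
  (P.desc_code hU).snd'.fst'.congr fun _ => rfl

/-- The number of wires `nq x₀ = |x₀| + ancillas`, unary. [folklore] -/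
theorem nq_code (hU : P.F.IsUniform) : CodeFP strE unE P.nq :=
  ((unAdd.comp (strLength.pair (P.ancillas_code hU))) :).congr fun _ => rfl

/-- The basis label of the initial state as a bit string: `x₀ 0^m`. [folklore] -/
theorem ofFn_w0 (x₀ : List Bool) : List.ofFn (P.w0 x₀) = x₀ ++ List.replicate (P.F.ancillas x₀.length) false :=
  ADH.ofFn_padInput x₀ _

/-- **The basis label `x₀ 0^m` on codes.** [cite: AaronsonChen2017, §2.2 (p. 12, "|x⟩|0^m⟩")] -/
theorem w0Bits_code (hU : P.F.IsUniform) : CodeFP strE strE (fun x₀ => List.ofFn (P.w0 x₀)) :=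
  ((strAppend.comp ((CodeFP.id strE).pair (zeros_code.comp (P.ancillas_code hU)))) :).congr fun x₀ =>
    (P.ofFn_w0 x₀).symm

/-- The number `T` of query gates of the circuit run on `x₀`, binary. [folklore] -/
theorem oracleQueries_code (hU : P.F.IsUniform) :
    CodeFP strE natE (fun x₀ => (P.F.circ x₀.length).oracleQueries) :=
  (((natLength strE).comp ((filter₀ isOracleCode_code).comp (P.gateCodes_code hU))) :).congr fun _ =>
    (oracleQueries_eq_length_filter _).symm

/-- **The budget `a = b = (|x₀| + T + 2)^c` on codes**, binary. [cite: AaronsonChen2017, §5.3 (p. 22, "Applying the Chernoff Bound": τ and the query budget)] -/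
theorem bud_code (hU : P.F.IsUniform) : CodeFP strE natE P.bud := by
  have hsum : CodeFP strE natE (fun x₀ => x₀.length + (P.F.circ x₀.length).oracleQueries + 2) :=
    ((natAdd.comp ((natAdd.comp (strNatLength.pair (P.oracleQueries_code hU))).pair (CodeFP.const strE 2))) :)
  exact ((natPow.comp (hsum.pair (CodeFP.const strE P.c))) :).congr fun _ => rfl

/-- **The gate codes of the prefix `gates.take n`** (`n` binary). [folklore] -/
theorem gateCodesTake_code (hU : P.F.IsUniform) :
    CodeFP (pairE strE natE) (rawE strE) (fun p => ((P.gates p.1).take p.2).map QGate.encode) := by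
  have hcodes : CodeFP (pairE strE natE) (rawE strE) (fun p => (P.gates p.1).map QGate.encode) :=
    ((P.gateCodes_code hU).comp (CodeFP.fst strE natE) :)
  have hlen : CodeFP (pairE strE natE) unE (fun p => ((P.gates p.1).map QGate.encode).length) :=
    ((ulength strE).comp hcodes :)
  have hmin : CodeFP (pairE strE natE) unE (fun p => min p.2 ((P.gates p.1).map QGate.encode).length) :=
    (unOfNatMin.comp (hlen.pair (CodeFP.snd strE natE)) :)
  exact (((rawTakeUn strE).comp (hmin.pair hcodes)) :).congr fun _ => by
    rw [take_min_length, List.map_take]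

/-- **The Hadamard count of the prefix `gates.take n`** (`n` binary), binary. [folklore] -/
theorem hCountTake_code (hU : P.F.IsUniform) :
    CodeFP (pairE strE natE) natE (fun p => hCount ((P.gates p.1).take p.2)) :=
  (((natLength strE).comp ((filter₀ isHCode_code).comp (P.gateCodesTake_code hU))) :).congr fun _ =>
    (hCount_eq_length_filter _).symm

/-- **The code of gate `n`** (`n` binary), with default `ε` past the end (every gate code is
nonempty: it starts with its tag bit). [folklore] -/
theorem gateCodeAt_code (hU : P.F.IsUniform) :
    CodeFP (pairE strE natE) strE (fun p => ((P.gates p.1).map QGate.encode).getD p.2 []) := by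
  have hcodes : CodeFP (pairE strE natE) (rawE strE) (fun p => (P.gates p.1).map QGate.encode) :=
    ((P.gateCodes_code hU).comp (CodeFP.fst strE natE) :)
  exact (((rawGetD strE (d := ([] : List Bool)) rfl).comp (hcodes.pair (CodeFP.snd strE natE))) :)

/-- Gate codes are nonempty. [folklore] -/
theorem encode_ne_nil (g : QGate cliffordT N) : g.encode ≠ [] := by
  cases g <;> simp [QGate.encode]

end AcProto

end Literature.Barriers.QuantumAdvantage

end
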